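import Summits.KontsevichZagierPeriods.KontsevichZagierPeriods.Theorems.UnfoldedStokesStokesGenerationFibrewiseRungScaling
import Summits.KontsevichZagierPeriods.KontsevichZagierPeriods.Theorems.UnfoldedStokesStokesGenerationFibrewiseClosureSum
import Summits.KontsevichZagierPeriods.KontsevichZagierPeriods.Theorems.UnfoldedStokesStokesGenerationStubPlaceCoords

/-!
# `StokesGeneration` (stmt-KontsevichZagierPeriods-3586), line `fibrewise_stokes` — rung 11 (corollaries): transpositions,
# reflections, and THEOREM D‴

Crux `Summit.KontsevichZagierPeriods.KontsevichZagierPeriods.Theses.UnfoldedStokes.StokesGeneration`; residual stub S2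
`stub_fibrewiseStokesGeneration`. Corollaries of the scaling certificate (`fibStokesDecomposable_scalingCore`,
`…FibrewiseRungScaling.lean`), all transcendence-free and value-free:
* `fibStokesDecomposable_moveCoord` / `fibStokesDecomposable_moveCoordRefl`: `h(x) − h(x[a ↦ x_b])`, `h(x) − h(x[a ↦ 1 − x_b])`;
* `fibStokesDecomposable_atomSwap`: the transposition `k(x_a) − k(x_b)` of an ARBITRARY `ℚ`-semialgebraic `C¹` atom (two
  elements; subsumes the exact/dlog/angular/rational transpositions of rungs 6, 9, 10d, 10e);
* `fibStokesDecomposable_atomRefl`: the reflection `k(x_a) − k(1 − x_a)` (four elements);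
* THEOREM D‴ `fibStokesDecomposable_separated_of_dimOne`: `Σᵢ kᵢ(x_{aᵢ})` is decomposable on `[0,1]^N` as soon as `Σᵢ kᵢ`
  is decomposable on `[0,1]` — separated variables reduce to dimension one (with rungs 8 III / 10c: THEOREMS D, D′).

References: M. Kontsevich, D. Zagier, *Periods* (2001), §1.2 rules (2), (3) and Conjecture 1.
-/

noncomputable section

set_option linter.dupNamespace false

namespace Summit.KontsevichZagierPeriods.KontsevichZagierPeriods.Cruxes.StokesGeneration.FibrewiseStokes

open MeasureTheory Set
open Literature.NumberTheory.Transcendental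
open Literature.NumberTheory.Transcendental.KZ
open Literature.ModelTheory.ExponentialFields (IsSemialgebraic)

/-! ## Moving, transposing and reflecting a coordinate -/

/-- **Moving a live coordinate onto an idle one.** Under the hypotheses of `fibStokesDecomposable_scalingCore`,
`h(x) − h(x[a ↦ x_b])` is fibrewise-Stokes decomposable (two elements, transcendence-free). [folklore] -/
theorem fibStokesDecomposable_moveCoord {N : ℕ} (a b : Fin N) (hab : a ≠ b) (h hₐ : (Fin N → ℝ) → ℝ)
    (hh : IsSemialgebraicFunOn ℚ (Set.pi Set.univ (fun _ : Fin N => Set.Icc (0:ℝ) 1)) h)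
    (hhₐ : IsSemialgebraicFunOn ℚ (Set.pi Set.univ (fun _ : Fin N => Set.Icc (0:ℝ) 1)) hₐ)
    (hhc : ContinuousOn h (Set.pi Set.univ (fun _ : Fin N => Set.Icc (0:ℝ) 1)))
    (hhₐc : ContinuousOn hₐ (Set.pi Set.univ (fun _ : Fin N => Set.Icc (0:ℝ) 1)))
    (hb : ∀ x s, h (Function.update x b s) = h x) (hbₐ : ∀ x s, hₐ (Function.update x b s) = hₐ x)
    (hd : ∀ x ∈ Set.pi Set.univ (fun _ : Fin N => Set.Icc (0:ℝ) 1), x a ∈ Set.Ioo (0:ℝ) 1 →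
      HasDerivAt (fun s => h (Function.update x a s)) (hₐ x) (x a)) :
    FibStokesDecomposable N (fun x => h x - h (Function.update x a (x b))) := by
  have := fibStokesDecomposable_scalingCore a b hab 1 0 (Or.inl ⟨rfl, rfl⟩) h hₐ hh hhₐ hhc hhₐc hb hbₐ hd
  simpa using this

/-- **Moving a live coordinate onto the reflection of an idle one.** Under the hypotheses of
`fibStokesDecomposable_scalingCore`, `h(x) − h(x[a ↦ 1 − x_b])` is fibrewise-Stokes decomposable. [folklore] -/
theorem fibStokesDecomposable_moveCoordRefl {N : ℕ} (a b : Fin N) (hab : a ≠ b) (h hₐ : (Fin N → ℝ) → ℝ)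
    (hh : IsSemialgebraicFunOn ℚ (Set.pi Set.univ (fun _ : Fin N => Set.Icc (0:ℝ) 1)) h)
    (hhₐ : IsSemialgebraicFunOn ℚ (Set.pi Set.univ (fun _ : Fin N => Set.Icc (0:ℝ) 1)) hₐ)
    (hhc : ContinuousOn h (Set.pi Set.univ (fun _ : Fin N => Set.Icc (0:ℝ) 1)))
    (hhₐc : ContinuousOn hₐ (Set.pi Set.univ (fun _ : Fin N => Set.Icc (0:ℝ) 1)))
    (hb : ∀ x s, h (Function.update x b s) = h x) (hbₐ : ∀ x s, hₐ (Function.update x b s) = hₐ x)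
    (hd : ∀ x ∈ Set.pi Set.univ (fun _ : Fin N => Set.Icc (0:ℝ) 1), x a ∈ Set.Ioo (0:ℝ) 1 →
      HasDerivAt (fun s => h (Function.update x a s)) (hₐ x) (x a)) :
    FibStokesDecomposable N (fun x => h x - h (Function.update x a (1 - x b))) := by
  have := fibStokesDecomposable_scalingCore a b hab (-1) 1 (Or.inr ⟨rfl, rfl⟩) h hₐ hh hhₐ hhc hhₐc hb hbₐ hd
  refine fibStokesDecomposable_congr_off_null N _ _ ∅
    Literature.ModelTheory.ExponentialFields.isSemialgebraic_empty measure_empty (fun x _ _ => ?_) this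
  rw [show (1:ℝ) + -1 * x b = 1 - x b by ring]

/-- Reading a one-variable `ℚ`-semialgebraic function along a coordinate of the closed unit cube is
`ℚ`-semialgebraic on the cube. [folklore] -/
theorem isSemialgebraicFunOn_read {N : ℕ} {g : ℝ → ℝ}
    (hg : IsSemialgebraicFunOn ℚ (Set.pi Set.univ (fun _ : Fin 1 => Set.Icc (0:ℝ) 1)) (fun z => g (z 0))) (a : Fin N) :
    IsSemialgebraicFunOn ℚ (Set.pi Set.univ (fun _ : Fin N => Set.Icc (0:ℝ) 1)) (fun x => g (x a)) := by
  have hCsa : IsSemialgebraic ℚ (Set.pi Set.univ (fun _ : Fin N => Set.Icc (0:ℝ) 1)) := by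
    rw [← cube_eq_pi]; exact isSemialgebraic_cube
  refine (isSemialgebraicFunOn_comp_coord hg (fun _ : Fin 1 => a)).mono (fun x hx => ?_) hCsa
  exact Set.mem_univ_pi.mpr fun _ => (Set.mem_univ_pi.mp hx) a

/-- Reading a one-variable `ℚ`-semialgebraic function along the REFLECTION of a coordinate of the closed unit cube
is `ℚ`-semialgebraic on the cube. [folklore] -/
theorem isSemialgebraicFunOn_read_refl {N : ℕ} {g : ℝ → ℝ}
    (hg : IsSemialgebraicFunOn ℚ (Set.pi Set.univ (fun _ : Fin 1 => Set.Icc (0:ℝ) 1)) (fun z => g (z 0))) (a : Fin N) :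
    IsSemialgebraicFunOn ℚ (Set.pi Set.univ (fun _ : Fin N => Set.Icc (0:ℝ) 1)) (fun x => g (1 - x a)) := by
  have hCsa : IsSemialgebraic ℚ (Set.pi Set.univ (fun _ : Fin N => Set.Icc (0:ℝ) 1)) := by
    rw [← cube_eq_pi]; exact isSemialgebraic_cube
  have hR : IsSemialgebraicMapOn ℚ (Set.pi Set.univ (fun _ : Fin N => Set.Icc (0:ℝ) 1))
      (fun x => Function.update x a (1 - x a)) := by
    refine IsSemialgebraicMapOn.of_forall hCsa fun j => ?_
    rcases eq_or_ne j a with rfl | hja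
    · exact ((isSemialgebraicFunOn_const_of_isAlgebraic hCsa isAlgebraic_one).fun_sub
        (isSemialgebraicFunOn_apply hCsa j)).congr fun x _ => by simp
    · exact (isSemialgebraicFunOn_apply hCsa j).congr fun x _ => by simp [Function.update_of_ne hja]
  have hmaps : Set.MapsTo (fun x => Function.update x a (1 - x a))
      (Set.pi Set.univ (fun _ : Fin N => Set.Icc (0:ℝ) 1)) (Set.pi Set.univ (fun _ : Fin N => Set.Icc (0:ℝ) 1)) := by
    intro x hx
    have hxa := (Set.mem_univ_pi.mp hx) a
    exact update_mem_cubePi hx a ⟨by linarith [hxa.2], by linarith [hxa.1]⟩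
  have := IsSemialgebraicFunOn.comp_isSemialgebraicMapOn_holds (isSemialgebraicFunOn_read hg a) hR hmaps
  exact this.congr fun x _ => by simp

/-- **The transposition of an arbitrary semialgebraic `C¹` atom.** For `k` `ℚ`-semialgebraic and continuous on `[0,1]`
with a `ℚ`-semialgebraic continuous derivative `k'` on `(0,1)`, and coordinates `a ≠ b` of `[0,1]^N`, the transposition
`k(x_a) − k(x_b)` is fibrewise-Stokes decomposable — two elements, no transcendence input (this subsumes the exact, dlog,
angular and rational transpositions of rungs 6, 9, 10d, 10e). [folklore; cite: KontsevichZagier2001, §1.2 rule (2)] -/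
theorem fibStokesDecomposable_atomSwap {N : ℕ} (a b : Fin N) (hab : a ≠ b) (k k' : ℝ → ℝ)
    (hk : IsSemialgebraicFunOn ℚ (Set.pi Set.univ (fun _ : Fin 1 => Set.Icc (0:ℝ) 1)) (fun z => k (z 0)))
    (hk' : IsSemialgebraicFunOn ℚ (Set.pi Set.univ (fun _ : Fin 1 => Set.Icc (0:ℝ) 1)) (fun z => k' (z 0)))
    (hkc : ContinuousOn k (Set.Icc (0:ℝ) 1)) (hk'c : ContinuousOn k' (Set.Icc (0:ℝ) 1))
    (hkd : ∀ u ∈ Set.Ioo (0:ℝ) 1, HasDerivAt k (k' u) u) :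
    FibStokesDecomposable N (fun x => k (x a) - k (x b)) := by
  have hmem : ∀ x ∈ Set.pi Set.univ (fun _ : Fin N => Set.Icc (0:ℝ) 1), ∀ i, x i ∈ Set.Icc (0:ℝ) 1 :=
    fun x hx i => (Set.mem_univ_pi.mp hx) i
  have := fibStokesDecomposable_moveCoord a b hab (fun x => k (x a)) (fun x => k' (x a))
    (isSemialgebraicFunOn_read hk a) (isSemialgebraicFunOn_read hk' a)
    (hkc.comp (continuous_apply a).continuousOn fun x hx => hmem x hx a)
    (hk'c.comp (continuous_apply a).continuousOn fun x hx => hmem x hx a)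
    (fun x s => by simp [Function.update_of_ne hab]) (fun x s => by simp [Function.update_of_ne hab])
    (fun x _ hxa => by simpa using hkd (x a) hxa)
  simpa using this

/-- **The reflection of an arbitrary semialgebraic `C¹` atom.** For `k` as in `fibStokesDecomposable_atomSwap` and
coordinates `a ≠ b` of `[0,1]^N` (`b` is only used as an auxiliary idle coordinate), `k(x_a) − k(1 − x_a)` is
fibrewise-Stokes decomposable — four elements, no transcendence input. [folklore; cite: KontsevichZagier2001, §1.2 rule (2)] -/
theorem fibStokesDecomposable_atomRefl {N : ℕ} (a b : Fin N) (hab : a ≠ b) (k k' : ℝ → ℝ)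
    (hk : IsSemialgebraicFunOn ℚ (Set.pi Set.univ (fun _ : Fin 1 => Set.Icc (0:ℝ) 1)) (fun z => k (z 0)))
    (hk' : IsSemialgebraicFunOn ℚ (Set.pi Set.univ (fun _ : Fin 1 => Set.Icc (0:ℝ) 1)) (fun z => k' (z 0)))
    (hkc : ContinuousOn k (Set.Icc (0:ℝ) 1)) (hk'c : ContinuousOn k' (Set.Icc (0:ℝ) 1))
    (hkd : ∀ u ∈ Set.Ioo (0:ℝ) 1, HasDerivAt k (k' u) u) :
    FibStokesDecomposable N (fun x => k (x a) - k (1 - x a)) := by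
  have hmem : ∀ x ∈ Set.pi Set.univ (fun _ : Fin N => Set.Icc (0:ℝ) 1), ∀ i, x i ∈ Set.Icc (0:ℝ) 1 :=
    fun x hx i => (Set.mem_univ_pi.mp hx) i
  have hrefl : ∀ u ∈ Set.Icc (0:ℝ) 1, 1 - u ∈ Set.Icc (0:ℝ) 1 := fun u hu => ⟨by linarith [hu.2], by linarith [hu.1]⟩
  have hreflo : ∀ u ∈ Set.Ioo (0:ℝ) 1, 1 - u ∈ Set.Ioo (0:ℝ) 1 := fun u hu => ⟨by linarith [hu.2], by linarith [hu.1]⟩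
  have hra : Continuous fun x : Fin N → ℝ => 1 - x a := continuous_const.sub (continuous_apply a)
  -- (i) `k(x_a) − k(1 − x_b)`
  have h1 : FibStokesDecomposable N (fun x => k (x a) - k (1 - x b)) := by
    have := fibStokesDecomposable_moveCoordRefl a b hab (fun x => k (x a)) (fun x => k' (x a))
      (isSemialgebraicFunOn_read hk a) (isSemialgebraicFunOn_read hk' a)
      (hkc.comp (continuous_apply a).continuousOn fun x hx => hmem x hx a)
      (hk'c.comp (continuous_apply a).continuousOn fun x hx => hmem x hx a)
      (fun x s => by simp [Function.update_of_ne hab]) (fun x s => by simp [Function.update_of_ne hab])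
      (fun x _ hxa => by simpa using hkd (x a) hxa)
    simpa using this
  -- (ii) `k(1 − x_a) − k(1 − x_b)`
  have h2 : FibStokesDecomposable N (fun x => k (1 - x a) - k (1 - x b)) := by
    have := fibStokesDecomposable_moveCoord a b hab (fun x => k (1 - x a)) (fun x => -k' (1 - x a))
      (isSemialgebraicFunOn_read_refl hk a) (isSemialgebraicFunOn_read_refl hk' a).fun_neg
      (hkc.comp hra.continuousOn fun x hx => hrefl _ (hmem x hx a))
      ((hk'c.comp hra.continuousOn fun x hx => hrefl _ (hmem x hx a)).neg)
      (fun x s => by simp [Function.update_of_ne hab]) (fun x s => by simp [Function.update_of_ne hab])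
      (fun x _ hxa => by
        simp only [Function.update_self]
        have := (hkd (1 - x a) (hreflo _ hxa)).comp (x a) ((hasDerivAt_id' (x a)).const_sub 1)
        exact this.congr_deriv (by ring))
    simpa using this
  refine fibStokesDecomposable_congr_off_null N _ _ ∅
    Literature.ModelTheory.ExponentialFields.isSemialgebraic_empty measure_empty (fun x _ _ => ?_)
    (fibStokesDecomposable_sub N _ _ h1 h2)
  ring

/-! ## THEOREM D‴: separated variables reduce to dimension one -/

/-- **Separated variables reduce to dimension one (THEOREM D‴).** For finitely many `ℚ`-semialgebraic `C¹` atoms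
`kᵢ` on `[0,1]` read along arbitrary coordinates `aᵢ` of `[0,1]^N`: if the one-variable sum `Σᵢ kᵢ(u)` is
fibrewise-Stokes decomposable on `[0,1]`, then so is the separated sum `Σᵢ kᵢ(x_{aᵢ})` on `[0,1]^N` — every atom is
transposed to a home coordinate (`fibStokesDecomposable_atomSwap`, transcendence-free) and the one-dimensional
decomposition is placed there (`stub_placeCoords`). With rungs 8/10c this yields THEOREMS D and D′.
[cite: KontsevichZagier2001, §1.2 Conjecture 1] -/
theorem fibStokesDecomposable_separated_of_dimOne {N : ℕ} {ι : Type*} [Fintype ι] (k k' : ι → ℝ → ℝ)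
    (a : ι → Fin N) (home : Fin N)
    (hk : ∀ i, IsSemialgebraicFunOn ℚ (Set.pi Set.univ (fun _ : Fin 1 => Set.Icc (0:ℝ) 1)) (fun z => k i (z 0)))
    (hk' : ∀ i, IsSemialgebraicFunOn ℚ (Set.pi Set.univ (fun _ : Fin 1 => Set.Icc (0:ℝ) 1)) (fun z => k' i (z 0)))
    (hkc : ∀ i, ContinuousOn (k i) (Set.Icc (0:ℝ) 1)) (hk'c : ∀ i, ContinuousOn (k' i) (Set.Icc (0:ℝ) 1))
    (hkd : ∀ i, ∀ u ∈ Set.Ioo (0:ℝ) 1, HasDerivAt (k i) (k' i u) u)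
    (h1 : FibStokesDecomposable 1 (fun z => ∑ i, k i (z 0))) :
    FibStokesDecomposable N (fun x => ∑ i, k i (x (a i))) := by
  classical
  have hmove : ∀ i, FibStokesDecomposable N (fun x => k i (x (a i)) - k i (x home)) := by
    intro i
    by_cases hi : a i = home
    · rw [hi]; simpa using fibStokesDecomposable_zero N
    · exact fibStokesDecomposable_atomSwap (a i) home hi (k i) (k' i) (hk i) (hk' i) (hkc i) (hk'c i) (hkd i)
  have hsum := fibStokesDecomposable_finsetSum Finset.univ _ fun i _ => hmove i
  have hhome : FibStokesDecomposable N (fun x => ∑ i, k i (x home)) := by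
    have := stub_placeCoords 1 _ h1 N (fun _ => home) fun _ _ _ => Subsingleton.elim _ _
    simpa using this
  refine fibStokesDecomposable_congr_off_null N _ _ ∅
    Literature.ModelTheory.ExponentialFields.isSemialgebraic_empty measure_empty (fun x _ _ => ?_)
    (fibStokesDecomposable_add N _ _ hsum hhome)
  simp only [Finset.sum_sub_distrib]
  ring

end Summit.KontsevichZagierPeriods.KontsevichZagierPeriods.Cruxes.StokesGeneration.FibrewiseStokes

end
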